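import Summits.AtomisticToContinuum.HydrodynamicLimit.Theorems.CollisionIsometryCLTDiffuseBackwardInfluenceDefs

/-!
# `DiffuseBackwardInfluence`, line `share-nondegeneracy-one-flight`, stub `stub_onePathBound` (2/5): mass transport with a score counter

Support file (`--supports stmt-AtomisticToContinuum-12950`): the generic bookkeeping of the one-path bound. A profile
`g : ι → ℕ → ℝ` is a mass distribution over (site, score counter); one exchange event at the pair `(p, q)` with
handed-over fractions `f` transports it by `transport e` (`e = 1`: one tracer, `e = 2`: a pair of conditionally
independent tracers making identical moves), raising the counter of the mass whose host scores. Proved: conservation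
of row sums, the first-moment bookkeeping, INVARIANT A for one event (`transport_two_le`, registered sub-goal
`onePath_transport_two_le`: the pair profile stays below `c^counter ×` the single profile when scoring hosts hand over
fractions in `[1 − c, c]`), and the scalar merge identity (`excess_step`).
-/

namespace Summit.AtomisticToContinuum.HydrodynamicLimit.Theorems.DiffuseBackwardInfluenceShare

open scoped BigOperators Topology ENNReal InnerProductSpace Classical
open Filter Set MeasureTheory
open Literature.Analysis.FluidPDE
open Literature.MathematicalPhysics.KineticTheory (localGibbsLaw hsDiameter)
open Summit.AtomisticToContinuum.HydrodynamicLimit.Theorems.DiffuseBackwardInfluenceNeg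

noncomputable section

namespace OnePath

/-! ## §2 Generic bookkeeping: mass transport with a score counter -/

section Transport

variable {ι : Type*} [DecidableEq ι]

/-- Sum of a function modified at two distinct points (adapted from the crux workfile
`IdeatorThreeSketch.lean`, `sum_twoPoint`). [folklore] -/
theorem sum_twoPoint [Fintype ι] {p q : ι} (hpq : p ≠ q) (f g : ι → ℝ) (a b : ℝ)
    (hg : ∀ i, g i = if i = p then a else if i = q then b else f i) :
    ∑ i, g i = ∑ i, f i + (a - f p) + (b - f q) := by
  have h : ∀ i, g i = f i + (if i = p then a - f p else 0) + (if i = q then b - f q else 0) := by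
    intro i
    rw [hg i]
    by_cases hp : i = p
    · rw [if_pos hp, if_pos hp, if_neg (fun hq => hpq (hp.symm.trans hq)), hp]; ring
    · rw [if_neg hp, if_neg hp]
      by_cases hq : i = q
      · rw [if_pos hq, if_pos hq, hq]; ring
      · rw [if_neg hq, if_neg hq]; ring
  calc ∑ i, g i = ∑ i, (f i + (if i = p then a - f p else 0) + (if i = q then b - f q else 0)) :=
        Finset.sum_congr rfl (fun i _ => h i)
    _ = ∑ i, f i + ∑ i, (if i = p then a - f p else 0) + ∑ i, (if i = q then b - f q else 0) := by
        rw [Finset.sum_add_distrib, Finset.sum_add_distrib]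
    _ = ∑ i, f i + (a - f p) + (b - f q) := by simp

/-- Shift of a counter profile by one unit if the event `b` happens (mass with counter `j − 1` moves to
counter `j`), the identity otherwise. -/
def bump (b : Prop) (g : ℕ → ℝ) : ℕ → ℝ := fun j => if b then (if j = 0 then 0 else g (j - 1)) else g j

/-- `bump` at a non-event is the identity. [folklore] -/
theorem bump_of_not {b : Prop} (hb : ¬ b) (g : ℕ → ℝ) (j : ℕ) : bump b g j = g j := by
  simp [bump, hb]

/-- `bump` at an event, counter `0`: nothing. [folklore] -/
theorem bump_zero_of {b : Prop} (hb : b) (g : ℕ → ℝ) : bump b g 0 = 0 := by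
  simp [bump, hb]

/-- `bump` at an event, counter `j + 1`: the old mass at counter `j`. [folklore] -/
theorem bump_succ_of {b : Prop} (hb : b) (g : ℕ → ℝ) (j : ℕ) : bump b g (j + 1) = g j := by
  simp [bump, hb]

/-- `bump` preserves nonnegativity. [folklore] -/
theorem bump_nonneg {b : Prop} {g : ℕ → ℝ} (hg : ∀ j, 0 ≤ g j) (j : ℕ) : 0 ≤ bump b g j := by
  unfold bump
  split_ifs
  · exact le_rfl
  · exact hg _
  · exact hg _

/-- Support of `bump`: if `g` vanishes above `T` then `bump b g` vanishes above `T + 1`. [folklore] -/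
theorem bump_eq_zero_of_lt {b : Prop} {g : ℕ → ℝ} {T : ℕ} (hg : ∀ j, T < j → g j = 0) (j : ℕ) (hj : T + 1 < j) :
    bump b g j = 0 := by
  unfold bump
  split_ifs with hb hj0
  · rfl
  · exact hg _ (by omega)
  · exact hg _ (by omega)

/-- What a nonzero value of `bump` says about `g`. [folklore] -/
theorem of_bump_ne_zero {b : Prop} {g : ℕ → ℝ} {j : ℕ} (h : bump b g j ≠ 0) :
    (b ∧ 1 ≤ j ∧ g (j - 1) ≠ 0) ∨ (¬ b ∧ g j ≠ 0) := by
  unfold bump at h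
  split_ifs at h with hb hj0
  · exact absurd rfl h
  · exact Or.inl ⟨hb, by omega, h⟩
  · exact Or.inr ⟨hb, h⟩

/-- Total mass is invariant under `bump` (on a range containing the support with one unit to spare). [folklore] -/
theorem sum_bump {b : Prop} (g : ℕ → ℝ) (K : ℕ) (hK : g K = 0) :
    ∑ j ∈ Finset.range (K + 1), bump b g j = ∑ j ∈ Finset.range (K + 1), g j := by
  by_cases hb : b
  · rw [Finset.sum_range_succ', bump_zero_of hb, add_zero, Finset.sum_range_succ, hK, add_zero]
    exact Finset.sum_congr rfl fun j _ => bump_succ_of hb g j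
  · exact Finset.sum_congr rfl fun j _ => bump_of_not hb g j

/-- First moment under `bump`: it grows by the total mass if the event happens. [folklore] -/
theorem sum_bump_mul {b : Prop} (g : ℕ → ℝ) (K : ℕ) (hK : g K = 0) :
    ∑ j ∈ Finset.range (K + 1), bump b g j * (j : ℝ) =
      ∑ j ∈ Finset.range (K + 1), g j * (j : ℝ) + if b then ∑ j ∈ Finset.range (K + 1), g j else 0 := by
  by_cases hb : b
  · rw [if_pos hb, Finset.sum_range_succ', bump_zero_of hb, Nat.cast_zero, mul_zero, add_zero,
      Finset.sum_range_succ (fun j => g j * (j : ℝ)) K, Finset.sum_range_succ g K, hK, zero_mul, add_zero,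
      add_zero, ← Finset.sum_add_distrib]
    refine Finset.sum_congr rfl fun j _ => ?_
    rw [bump_succ_of hb g j, Nat.cast_succ]
    ring
  · rw [if_neg hb, add_zero]
    exact Finset.sum_congr rfl fun j _ => by rw [bump_of_not hb g j]

/-- One exchange event on (site, counter)-profiles with exponent `e` (`e = 1`: ONE tracer; `e = 2`: a PAIR of
conditionally independent tracers making the same move): at the reflected pair `(p, q)` with handed-over fractions
`f`, the mass at `p` keeps the fraction `(1 − f p)^e` and sends `(f p)^e` to `q` (and symmetrically), the counter of
the mass that was at `p` (resp. `q`) being raised by one if `p` (resp. `q`) scores at this event. -/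
def transport (e : ℕ) (p q : ι) (f : ι → ℝ) (s : ι → Prop) (g : ι → ℕ → ℝ) : ι → ℕ → ℝ :=
  fun i j =>
    if i = p then (1 - f p) ^ e * bump (s p) (g p) j + f q ^ e * bump (s q) (g q) j
    else if i = q then (1 - f q) ^ e * bump (s q) (g q) j + f p ^ e * bump (s p) (g p) j
    else g i j

variable {e : ℕ} {p q : ι} {f : ι → ℝ} {s : ι → Prop} {g : ι → ℕ → ℝ}

/-- `transport` at the first endpoint. [folklore] -/
theorem transport_fst (e : ℕ) (p q : ι) (f : ι → ℝ) (s : ι → Prop) (g : ι → ℕ → ℝ) (j : ℕ) :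
    transport e p q f s g p j = (1 - f p) ^ e * bump (s p) (g p) j + f q ^ e * bump (s q) (g q) j := by
  simp [transport]

/-- `transport` at the second endpoint. [folklore] -/
theorem transport_snd (hpq : p ≠ q) (e : ℕ) (f : ι → ℝ) (s : ι → Prop) (g : ι → ℕ → ℝ) (j : ℕ) :
    transport e p q f s g q j = (1 - f q) ^ e * bump (s q) (g q) j + f p ^ e * bump (s p) (g p) j := by
  simp [transport, hpq.symm]

/-- `transport` away from the pair is the identity. [folklore] -/
theorem transport_of_ne {i : ι} (hp : i ≠ p) (hq : i ≠ q) (e : ℕ) (f : ι → ℝ) (s : ι → Prop) (g : ι → ℕ → ℝ)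
    (j : ℕ) : transport e p q f s g i j = g i j := by
  simp [transport, hp, hq]

/-- `transport` preserves nonnegativity for fractions in `[0, 1]`. [folklore] -/
theorem transport_nonneg (hp0 : 0 ≤ f p) (hp1 : f p ≤ 1) (hq0 : 0 ≤ f q) (hq1 : f q ≤ 1)
    (hg : ∀ i j, 0 ≤ g i j) (e : ℕ) (s : ι → Prop) (i : ι) (j : ℕ) : 0 ≤ transport e p q f s g i j := by
  unfold transport
  split_ifs
  · exact add_nonneg (mul_nonneg (pow_nonneg (sub_nonneg.2 hp1) _) (bump_nonneg (hg p) j))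
      (mul_nonneg (pow_nonneg hq0 _) (bump_nonneg (hg q) j))
  · exact add_nonneg (mul_nonneg (pow_nonneg (sub_nonneg.2 hq1) _) (bump_nonneg (hg q) j))
      (mul_nonneg (pow_nonneg hp0 _) (bump_nonneg (hg p) j))
  · exact hg i j

/-- Support of `transport`: counters grow by at most one. [folklore] -/
theorem transport_eq_zero_of_lt {T : ℕ} (hg : ∀ i j, T < j → g i j = 0) (e : ℕ) (p q : ι) (f : ι → ℝ)
    (s : ι → Prop) (i : ι) (j : ℕ) (hj : T + 1 < j) : transport e p q f s g i j = 0 := by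
  unfold transport
  split_ifs
  · rw [bump_eq_zero_of_lt (hg p) j hj, bump_eq_zero_of_lt (hg q) j hj]; ring
  · rw [bump_eq_zero_of_lt (hg q) j hj, bump_eq_zero_of_lt (hg p) j hj]; ring
  · exact hg i j (by omega)

/-- Row sums of `transport` at the first endpoint: `(1 − f p)^e P + (f q)^e Q`. [folklore] -/
theorem sum_transport_fst (e : ℕ) (p q : ι) (f : ι → ℝ) (s : ι → Prop) (g : ι → ℕ → ℝ) (K : ℕ)
    (hK : ∀ i, g i K = 0) :
    ∑ j ∈ Finset.range (K + 1), transport e p q f s g p j =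
      (1 - f p) ^ e * ∑ j ∈ Finset.range (K + 1), g p j + f q ^ e * ∑ j ∈ Finset.range (K + 1), g q j := by
  simp_rw [transport_fst]
  rw [Finset.sum_add_distrib, ← Finset.mul_sum, ← Finset.mul_sum, sum_bump _ K (hK p), sum_bump _ K (hK q)]

/-- Row sums of `transport` at the second endpoint: `(1 − f q)^e Q + (f p)^e P`. [folklore] -/
theorem sum_transport_snd (hpq : p ≠ q) (e : ℕ) (f : ι → ℝ) (s : ι → Prop) (g : ι → ℕ → ℝ) (K : ℕ)
    (hK : ∀ i, g i K = 0) :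
    ∑ j ∈ Finset.range (K + 1), transport e p q f s g q j =
      (1 - f q) ^ e * ∑ j ∈ Finset.range (K + 1), g q j + f p ^ e * ∑ j ∈ Finset.range (K + 1), g p j := by
  simp_rw [transport_snd hpq]
  rw [Finset.sum_add_distrib, ← Finset.mul_sum, ← Finset.mul_sum, sum_bump _ K (hK p), sum_bump _ K (hK q)]

/-- First moments of `transport 1` at the two endpoints together: they grow by the scoring masses. [folklore] -/
theorem sum_transport_mul_fst_add_snd (hpq : p ≠ q) (f : ι → ℝ) (s : ι → Prop) (g : ι → ℕ → ℝ) (K : ℕ)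
    (hK : ∀ i, g i K = 0) :
    ∑ j ∈ Finset.range (K + 1), transport 1 p q f s g p j * (j : ℝ) +
        ∑ j ∈ Finset.range (K + 1), transport 1 p q f s g q j * (j : ℝ) =
      ∑ j ∈ Finset.range (K + 1), g p j * (j : ℝ) + ∑ j ∈ Finset.range (K + 1), g q j * (j : ℝ) +
        (if s p then ∑ j ∈ Finset.range (K + 1), g p j else 0) +
        (if s q then ∑ j ∈ Finset.range (K + 1), g q j else 0) := by
  simp_rw [transport_fst, transport_snd hpq, pow_one, add_mul, Finset.sum_add_distrib, mul_assoc, ← Finset.mul_sum,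
    sum_bump_mul _ K (hK p), sum_bump_mul _ K (hK q)]
  ring

/-- The scalar heart of Invariant A: a move with weight `w ∈ [0,1]` contracts the pair potential by `w² ≤ w`, and
by `w² ≤ (1 − η) w` if the move scores (then `w ≤ 1 − η`, or the single potential vanishes). [folklore] -/
theorem sq_mul_bump_le {b : Prop} {w c : ℝ} {G1 G2 : ℕ → ℝ} (hw0 : 0 ≤ w) (hw1 : w ≤ 1) (hc0 : 0 ≤ c)
    (hG1 : ∀ j, 0 ≤ G1 j) (hle : ∀ j, G2 j ≤ c ^ j * G1 j) (hb : b → (∀ j, G1 j = 0) ∨ w ≤ c) (j : ℕ) :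
    w ^ 2 * bump b G2 j ≤ c ^ j * (w * bump b G1 j) := by
  by_cases hbb : b
  · rcases j with _ | j
    · rw [bump_zero_of hbb, bump_zero_of hbb]; simp
    rw [bump_succ_of hbb, bump_succ_of hbb]
    rcases hb hbb with h0 | hwc
    · have h2 : G2 j ≤ 0 := by simpa [h0 j] using hle j
      rw [h0 j]
      nlinarith [sq_nonneg w]
    · calc w ^ 2 * G2 j ≤ w ^ 2 * (c ^ j * G1 j) := mul_le_mul_of_nonneg_left (hle j) (sq_nonneg w)
        _ = w * (c ^ j * G1 j) * w := by ring
        _ ≤ w * (c ^ j * G1 j) * c :=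
            mul_le_mul_of_nonneg_left hwc (mul_nonneg hw0 (mul_nonneg (pow_nonneg hc0 _) (hG1 j)))
        _ = c ^ (j + 1) * (w * G1 j) := by ring
  · rw [bump_of_not hbb, bump_of_not hbb]
    calc w ^ 2 * G2 j ≤ w ^ 2 * (c ^ j * G1 j) := mul_le_mul_of_nonneg_left (hle j) (sq_nonneg w)
      _ = w * (c ^ j * G1 j) * w := by ring
      _ ≤ w * (c ^ j * G1 j) * 1 :=
          mul_le_mul_of_nonneg_left hw1 (mul_nonneg hw0 (mul_nonneg (pow_nonneg hc0 _) (hG1 j)))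
      _ = c ^ j * (w * G1 j) := by ring

/-- INVARIANT A, one event: if the pair potential is dominated by `c^counter ×` the single potential before the
event, it is so after it, provided every scoring endpoint either carries no single mass or hands over a fraction in
`[1 − c, c]`. [folklore] -/
theorem transport_two_le (hpq : p ≠ q) {c : ℝ} (hc0 : 0 ≤ c) (hp0 : 0 ≤ f p) (hp1 : f p ≤ 1) (hq0 : 0 ≤ f q)
    (hq1 : f q ≤ 1) {g1 g2 : ι → ℕ → ℝ} (hg1 : ∀ i j, 0 ≤ g1 i j) (hle : ∀ i j, g2 i j ≤ c ^ j * g1 i j)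
    (hsp : s p → (∀ j, g1 p j = 0) ∨ (1 - f p ≤ c ∧ f p ≤ c))
    (hsq : s q → (∀ j, g1 q j = 0) ∨ (1 - f q ≤ c ∧ f q ≤ c)) (i : ι) (j : ℕ) :
    transport 2 p q f s g2 i j ≤ c ^ j * transport 1 p q f s g1 i j := by
  have hp' : s p → (∀ j, g1 p j = 0) ∨ 1 - f p ≤ c := fun h => (hsp h).imp_right And.left
  have hp'' : s p → (∀ j, g1 p j = 0) ∨ f p ≤ c := fun h => (hsp h).imp_right And.right
  have hq' : s q → (∀ j, g1 q j = 0) ∨ 1 - f q ≤ c := fun h => (hsq h).imp_right And.left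
  have hq'' : s q → (∀ j, g1 q j = 0) ∨ f q ≤ c := fun h => (hsq h).imp_right And.right
  by_cases hip : i = p
  · subst hip
    rw [transport_fst, transport_fst, pow_one, pow_one, mul_add]
    exact add_le_add
      (sq_mul_bump_le (sub_nonneg.2 hp1) (sub_le_self _ hp0) hc0 (hg1 i) (hle i) hp' j)
      (sq_mul_bump_le hq0 hq1 hc0 (hg1 q) (hle q) hq'' j)
  by_cases hiq : i = q
  · subst hiq
    rw [transport_snd hpq, transport_snd hpq, pow_one, pow_one, mul_add]
    exact add_le_add
      (sq_mul_bump_le (sub_nonneg.2 hq1) (sub_le_self _ hq0) hc0 (hg1 i) (hle i) hq' j)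
      (sq_mul_bump_le hp0 hp1 hc0 (hg1 p) (hle p) hp'' j)
  rw [transport_of_ne hip hiq, transport_of_ne hip hiq]
  exact hle i j

/-- The merge identity, scalar form: writing `e_i := μ_i² − ν_i ≥ 0` for the excess of the together-mass over the
never-split mass, one exchange event keeps the excesses nonnegative and raises their total by at most the merge
mass `2 μ_p μ_q (f_p (1 − f_q) + f_q (1 − f_p))`. [folklore] -/
theorem excess_step {μp μq νp νq fp fq : ℝ} (hp0 : 0 ≤ fp) (hp1 : fp ≤ 1) (hq0 : 0 ≤ fq) (hq1 : fq ≤ 1)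
    (hμp : 0 ≤ μp) (hμq : 0 ≤ μq) (hep : νp ≤ μp ^ 2) (heq : νq ≤ μq ^ 2) :
    (1 - fp) ^ 2 * νp + fq ^ 2 * νq ≤ ((1 - fp) * μp + fq * μq) ^ 2 ∧
    (1 - fq) ^ 2 * νq + fp ^ 2 * νp ≤ ((1 - fq) * μq + fp * μp) ^ 2 ∧
    (((1 - fp) * μp + fq * μq) ^ 2 - ((1 - fp) ^ 2 * νp + fq ^ 2 * νq)) +
      (((1 - fq) * μq + fp * μp) ^ 2 - ((1 - fq) ^ 2 * νq + fp ^ 2 * νp)) ≤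
      (μp ^ 2 - νp) + (μq ^ 2 - νq) + 2 * μp * μq * (fp * (1 - fq) + fq * (1 - fp)) := by
  refine ⟨?_, ?_, ?_⟩
  · nlinarith [mul_nonneg (sq_nonneg (1 - fp)) (sub_nonneg.2 hep), mul_nonneg (sq_nonneg fq) (sub_nonneg.2 heq),
      mul_nonneg (mul_nonneg (sub_nonneg.2 hp1) hq0) (mul_nonneg hμp hμq)]
  · nlinarith [mul_nonneg (sq_nonneg (1 - fq)) (sub_nonneg.2 heq), mul_nonneg (sq_nonneg fp) (sub_nonneg.2 hep),
      mul_nonneg (mul_nonneg (sub_nonneg.2 hq1) hp0) (mul_nonneg hμp hμq)]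
  · nlinarith [mul_nonneg (mul_nonneg hp0 (sub_nonneg.2 hp1)) (sub_nonneg.2 hep),
      mul_nonneg (mul_nonneg hq0 (sub_nonneg.2 hq1)) (sub_nonneg.2 heq)]

end Transport

end OnePath

/-- INVARIANT A FOR ONE EVENT (registered sub-goal, `OnePath.transport_two_le` on `Fin (N + 1)`). [folklore] -/
theorem onePath_transport_two_le : ∀ (N : ℕ) (p q : Fin (N + 1)), p ≠ q → ∀ (c : ℝ), 0 ≤ c → ∀ (f : Fin (N + 1) → ℝ), 0 ≤ f p → f p ≤ 1 → 0 ≤ f q → f q ≤ 1 → ∀ (s : Fin (N + 1) → Prop) (g1 g2 : Fin (N + 1) → ℕ → ℝ), (∀ i j, 0 ≤ g1 i j) → (∀ i j, g2 i j ≤ c ^ j * g1 i j) → (s p → (∀ j, g1 p j = 0) ∨ (1 - f p ≤ c ∧ f p ≤ c)) → (s q → (∀ j, g1 q j = 0) ∨ (1 - f q ≤ c ∧ f q ≤ c)) → ∀ (i : Fin (N + 1)) (j : ℕ), OnePath.transport 2 p q f s g2 i j ≤ c ^ j * OnePath.transport 1 p q f s g1 i j :=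
  fun _ _ _ hpq _ hc0 _ hp0 hp1 hq0 hq1 _ _ _ hg1 hle hsp hsq i j =>
    OnePath.transport_two_le hpq hc0 hp0 hp1 hq0 hq1 hg1 hle hsp hsq i j

end

end Summit.AtomisticToContinuum.HydrodynamicLimit.Theorems.DiffuseBackwardInfluenceShare
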